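import Mathlib
import Summits.ValiantsHypothesis.ValiantsHypothesis.Theorems.GrenetZeonTwoDimCoefficientsDualUnipotentLevelFlat

/-!
# Crux `GrenetZeon.TwoDimCoefficients` (stmt-ValiantsHypothesis-8062), stub `stub_dualUnipotent`:
# the BLOCK RUNG — a block-upper pencil with `g` levels of sizes `b_t` forces `n² ≤ 2gn + Σ_t b_t²`
# (wild diagonal blocks allowed; small blocks ⟹ `m ≳ n^{3/2}/(2√2)`)

This is the `k`-STEP version of the triangularisable rung (memo
`Cruxes/TwoDimCoefficients/TRIANGULARISABLE-RUNG.md`, Remark (c): "it suffices that the pencil preserve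
a flag with small quotients; the diagonal blocks may be WILD nilpotent spaces"), in the currency of
this crux and with NO hypothesis on the diagonal blocks — not even nilpotency:

* `sq_le_of_blockUpper` — if `per_n = tr(N^d·M)` with `N`, `M` affine `m × m` pencils and `N`
  block-upper-triangular for a level function `lev : Fin m → ℕ` with `< g` levels
  (`N i j = 0` whenever `lev j < lev i`), then
  `n² ≤ 2·g·n + #{(i, j) : lev i = lev j}` (`= 2gn + Σ_t b_t²`).
  Proof: the directions `v` killing the linear coefficients of ALL diagonal-block entries form the
  kernel `K` of a linear map into `ℂ^{#{(i,j) : lev i = lev j}}`, so `codim K ≤ Σ_t b_t²`, while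
  `dim K ≤ 2gn` is the tree's level flatness `finrank_le_of_diagStill` (`per_n` has degree `≤ g` on
  every coset of `K`, LEMMA_g); rank–nullity.
* `card_sameLevel_le` — if every level has `≤ s` members then `#{(i,j) : lev i = lev j} ≤ s·m`;
  `sq_le_of_blockUpper_small` — hence `n² ≤ 2gn + s·m`: with `g ≈ m/s` levels of size `≤ s ≈ √(2n)`
  this is `m ≳ n^{3/2}/(2√2)`, the triangularisable rate, for EVERY pencil admitting an invariant
  flag with small quotients (conjugate first: `isAffine_conj`, `tr((P⁻¹NP)^d(P⁻¹MP)) = tr(N^dM)`).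
* §Coarsening (appended) `sq_le_of_blockUpper_maxLevel` — ANY number of levels, each of size `≤ D`
  (e.g. a composition series with small irreducible quotients) ⟹ `n² ≤ 2(m/D + 1)·n + 2D·m`, by
  regrouping consecutive levels into `< m/D + 1` coarse levels of size `≤ 2D` (`card_coarse_le`).

Use (research census of leafhand-val-grenetzeon-2-g3, item evidence `census-8062-g3.md` §5): this is
the per-side half of the IRREDUCIBLE-BLOCK RECURSION — if irreducible nilpotent spaces of `M_d(ℂ)`
had dimension `≤ (1/2 − ε₀)d²` (Mathes–Omladič–Radjavi 1991, §5, open QUESTION), the Jordan–Hölder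
flag of a near-Gerstenhaber-extremal pencil would have all quotients small and this file would give
`m ≥ (√2 + c·ε₀)·n`.

HONEST FRAMING: a sub-case rung (pencils with a small-quotient invariant flag); the located open
point (wild pencils with a LARGE irreducible block) is untouched; the stub, the crux (an ASIDE item)
and `VP ≠ VNP` are not moved.

References: M. Gerstenhaber, Amer. J. Math. 80 (1958); B. Mathes, M. Omladič, H. Radjavi, Linear
Algebra Appl. 149 (1991) 215–225, §5.
-/

-- single-conjunct layout `Summits/ValiantsHypothesis/ValiantsHypothesis`: the duplicated namespace
-- component is mandated by the tree.
set_option linter.dupNamespace false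

noncomputable section

namespace Summit.ValiantsHypothesis.ValiantsHypothesis.Cruxes.TwoDimCoefficients.DimTwoCases

open MvPolynomial Matrix
open Literature.Computability.AlgebraicComplexity

variable {n m : ℕ}

/-- **The block rung.**  `per_n = tr(N^d·M)` with `N`, `M` affine, `N` block-upper-triangular for a
level function with `< g` levels ⟹ `n² ≤ 2gn + #{(i,j) : lev i = lev j}`.  No hypothesis on the
diagonal blocks. [folklore] -/
theorem sq_le_of_blockUpper {d g : ℕ} (N M : AffMat n m) (hN : IsAffine N) (hM : IsAffine M)
    (lev : Fin m → ℕ) (hup : ∀ i j : Fin m, lev j < lev i → N i j = 0) (hg : ∀ u : Fin m, lev u < g)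
    (hper : perPoly (Fin n) ℂ = (N ^ d * M).trace) :
    n ^ 2 ≤ 2 * g * n + Fintype.card {p : Fin m × Fin m // lev p.1 = lev p.2} := by
  classical
  -- the diagonal-block coefficient map
  let Φ : (Fin n × Fin n → ℂ) →ₗ[ℂ] ({p : Fin m × Fin m // lev p.1 = lev p.2} → ℂ) :=
    { toFun := fun v p => ∑ c, v c * coeff (Finsupp.single c 1) (N p.1.1 p.1.2)
      map_add' := fun v w => by
        ext p
        simp only [Pi.add_apply, add_mul, Finset.sum_add_distrib]
      map_smul' := fun a v => by
        ext p
        simp only [Pi.smul_apply, smul_eq_mul, RingHom.id_apply, Finset.mul_sum, mul_assoc] }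
  have hK : ∀ v ∈ LinearMap.ker Φ, ∀ i j : Fin m, lev i = lev j →
      ∑ c, v c * coeff (Finsupp.single c 1) (N i j) = 0 := by
    intro v hv i j hij
    have h := congr_fun (LinearMap.mem_ker.1 hv) ⟨(i, j), hij⟩
    simpa [Φ] using h
  have hker : Module.finrank ℂ (LinearMap.ker Φ) ≤ 2 * g * n :=
    finrank_le_of_diagStill N M lev (LinearMap.ker Φ) hN hM hup hg hper hK
  have hrange : Module.finrank ℂ (LinearMap.range Φ) ≤
      Fintype.card {p : Fin m × Fin m // lev p.1 = lev p.2} := by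
    calc Module.finrank ℂ (LinearMap.range Φ)
        ≤ Module.finrank ℂ ({p : Fin m × Fin m // lev p.1 = lev p.2} → ℂ) :=
          Submodule.finrank_le _
      _ = Fintype.card {p : Fin m × Fin m // lev p.1 = lev p.2} :=
          Module.finrank_fintype_fun_eq_card ℂ
  have hsum : Module.finrank ℂ (LinearMap.range Φ) + Module.finrank ℂ (LinearMap.ker Φ) = n ^ 2 := by
    rw [LinearMap.finrank_range_add_finrank_ker Φ, Module.finrank_fintype_fun_eq_card,
      Fintype.card_prod, Fintype.card_fin, sq]
  omega

/-- Counting: if every level has at most `s` members, the number of same-level pairs is `≤ s·m`.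
[folklore] -/
theorem card_sameLevel_le (lev : Fin m → ℕ) (s : ℕ)
    (hs : ∀ i : Fin m, Fintype.card {j : Fin m // lev j = lev i} ≤ s) :
    Fintype.card {p : Fin m × Fin m // lev p.1 = lev p.2} ≤ s * m := by
  classical
  -- fibre over the first coordinate
  have e : {p : Fin m × Fin m // lev p.1 = lev p.2} ≃ (Σ i : Fin m, {j : Fin m // lev j = lev i}) :=
    { toFun := fun p => ⟨p.1.1, ⟨p.1.2, p.2.symm⟩⟩
      invFun := fun q => ⟨(q.1, q.2.1), q.2.2.symm⟩
      left_inv := fun p => by rcases p with ⟨⟨i, j⟩, h⟩; rfl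
      right_inv := fun q => by rcases q with ⟨i, ⟨j, h⟩⟩; rfl }
  have h1 : Fintype.card {p : Fin m × Fin m // lev p.1 = lev p.2} =
      ∑ i : Fin m, Fintype.card {j : Fin m // lev j = lev i} := by
    rw [Fintype.card_congr e, Fintype.card_sigma]
  rw [h1]
  calc ∑ i : Fin m, Fintype.card {j : Fin m // lev j = lev i} ≤ ∑ _i : Fin m, s :=
        Finset.sum_le_sum fun i _ => hs i
    _ = s * m := by rw [Finset.sum_const, Finset.card_univ, Fintype.card_fin, smul_eq_mul, mul_comm]

/-- **Small blocks.**  `per_n = tr(N^d·M)`, `N` block-upper-triangular with `< g` levels, every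
level of size `≤ s` ⟹ `n² ≤ 2gn + s·m`.  With `g ≈ m/s` and `s ≈ √(2n)`: `m ≳ n^{3/2}/(2√2)`, the
triangularisable rate, for WILD diagonal blocks. [folklore] -/
theorem sq_le_of_blockUpper_small {d g s : ℕ} (N M : AffMat n m) (hN : IsAffine N) (hM : IsAffine M)
    (lev : Fin m → ℕ) (hup : ∀ i j : Fin m, lev j < lev i → N i j = 0) (hg : ∀ u : Fin m, lev u < g)
    (hs : ∀ i : Fin m, Fintype.card {j : Fin m // lev j = lev i} ≤ s)
    (hper : perPoly (Fin n) ℂ = (N ^ d * M).trace) :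
    n ^ 2 ≤ 2 * g * n + s * m :=
  (sq_le_of_blockUpper N M hN hM lev hup hg hper).trans
    (Nat.add_le_add_left (card_sameLevel_le lev s hs) _)

/-! ### Coarsening: many small levels ⟹ few levels of size `< 2D` -/

section Coarsen

variable {m : ℕ}

/-- The coarse level of `i`: the number of indices of strictly smaller level, divided by `D`.
(Local notation only — an `abbrev`-free `fun`.) [folklore] -/
theorem coarse_mono (lev : Fin m → ℕ) (D : ℕ) {i j : Fin m} (h : lev j ≤ lev i) :
    Fintype.card {k : Fin m // lev k < lev j} / D ≤ Fintype.card {k : Fin m // lev k < lev i} / D := by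
  refine Nat.div_le_div_right (Fintype.card_le_of_embedding ⟨fun k => ⟨k.1, lt_of_lt_of_le k.2 h⟩, ?_⟩)
  intro a b hab
  exact Subtype.ext (by simpa using congrArg Subtype.val hab)

/-- The coarse levels are `< m / D + 1`. [folklore] -/
theorem coarse_lt (lev : Fin m → ℕ) (D : ℕ) (i : Fin m) :
    Fintype.card {k : Fin m // lev k < lev i} / D < m / D + 1 := by
  have h : Fintype.card {k : Fin m // lev k < lev i} ≤ m := by
    simpa using Fintype.card_subtype_le (fun k : Fin m => lev k < lev i)
  exact Nat.lt_succ_of_le (Nat.div_le_div_right h)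

/-- Counting indices with level in a window: `#{k : a ≤ lev k ≤ b} + #{k : lev k < a} = #{k : lev k < b} + #{k : lev k = b}`
for `a ≤ b`. [folklore] -/
theorem card_window (lev : Fin m → ℕ) {a b : ℕ} (hab : a ≤ b) :
    Fintype.card {k : Fin m // a ≤ lev k ∧ lev k ≤ b} + Fintype.card {k : Fin m // lev k < a} =
      Fintype.card {k : Fin m // lev k < b} + Fintype.card {k : Fin m // lev k = b} := by
  classical
  simp only [Fintype.card_subtype]
  rw [← Finset.card_union_of_disjoint, ← Finset.card_union_of_disjoint]
  · congr 1
    ext k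
    simp only [Finset.mem_union, Finset.mem_filter, Finset.mem_univ, true_and]
    omega
  · exact Finset.disjoint_filter.2 fun k _ h1 h2 => by omega
  · exact Finset.disjoint_filter.2 fun k _ h1 h2 => by omega

/-- **Coarse levels are small.**  If every level has `≤ D` members (`D ≥ 1`), every coarse level has
`< 2D` members: all its indices have levels in a window `[a, b]` whose prefix counts lie in one
interval `[qD, qD + D)`. [folklore] -/
theorem card_coarse_le (lev : Fin m → ℕ) (D : ℕ) (hD : 1 ≤ D)
    (hs : ∀ i : Fin m, Fintype.card {j : Fin m // lev j = lev i} ≤ D) (i : Fin m) :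
    Fintype.card {j : Fin m // Fintype.card {k : Fin m // lev k < lev j} / D =
      Fintype.card {k : Fin m // lev k < lev i} / D} ≤ 2 * D := by
  classical
  set q := Fintype.card {k : Fin m // lev k < lev i} / D with hq
  -- the coarse class of `i`, as a finset, with its extreme levels
  set G : Finset (Fin m) := Finset.univ.filter fun j =>
    Fintype.card {k : Fin m // lev k < lev j} / D = q with hG
  have hiG : i ∈ G := by simp [hG, hq]
  have hGne : G.Nonempty := ⟨i, hiG⟩
  obtain ⟨jmin, hjmin, hmin⟩ := Finset.exists_min_image G lev hGne
  obtain ⟨jmax, hjmax, hmax⟩ := Finset.exists_max_image G lev hGne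
  have hcl : ∀ j ∈ G, Fintype.card {k : Fin m // lev k < lev j} / D = q := fun j hj => by
    simpa [hG] using hj
  -- prefix counts of the extreme levels lie in `[qD, qD + D)`
  have hlo : q * D ≤ Fintype.card {k : Fin m // lev k < lev jmin} := by
    rw [← hcl jmin hjmin]; exact Nat.div_mul_le_self _ _
  have hhi : Fintype.card {k : Fin m // lev k < lev jmax} < q * D + D := by
    have h2 := Nat.lt_mul_div_succ (Fintype.card {k : Fin m // lev k < lev jmax}) (show 0 < D by omega)
    rw [hcl jmax hjmax] at h2
    simpa [mul_add, mul_comm] using h2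
  -- `G ⊆ {j : lev jmin ≤ lev j ≤ lev jmax}`
  have hsub : G.card ≤ Fintype.card {k : Fin m // lev jmin ≤ lev k ∧ lev k ≤ lev jmax} := by
    rw [Fintype.card_subtype]
    exact Finset.card_le_card fun j hj => by
      simp only [Finset.mem_filter, Finset.mem_univ, true_and]
      exact ⟨hmin j hj, hmax j hj⟩
  have hwin := card_window lev (hmin jmax hjmax)
  have hb := hs jmax
  have hcard : Fintype.card {j : Fin m // Fintype.card {k : Fin m // lev k < lev j} / D = q} = G.card := by
    rw [hG, Fintype.card_subtype]
  rw [hcard]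
  omega

end Coarsen

/-- **Small quotients ⟹ the rung, with coarsening.**  If `per_n = tr(N^d·M)` (`N`, `M` affine) and
`N` is block-upper-triangular for a level function ALL of whose levels have `≤ D` members (`D ≥ 1`,
any number of levels — e.g. a composition series with small irreducible quotients), then
`n² ≤ 2(m/D + 1)·n + 2D·m`.  (Coarse levels `⌊#{k : lev k < lev i}/D⌋`: monotone in `lev`, fewer
than `m/D + 1` of them, each of size `≤ 2D`; then `sq_le_of_blockUpper_small`.)  With `D ≈ √n`:
`m ≳ n^{3/2}/4`. [folklore] -/
theorem sq_le_of_blockUpper_maxLevel {d D : ℕ} (N M : AffMat n m) (hN : IsAffine N)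
    (hM : IsAffine M) (lev : Fin m → ℕ) (hup : ∀ i j : Fin m, lev j < lev i → N i j = 0)
    (hD : 1 ≤ D) (hs : ∀ i : Fin m, Fintype.card {j : Fin m // lev j = lev i} ≤ D)
    (hper : perPoly (Fin n) ℂ = (N ^ d * M).trace) :
    n ^ 2 ≤ 2 * (m / D + 1) * n + 2 * D * m := by
  let lev' : Fin m → ℕ := fun i => Fintype.card {k : Fin m // lev k < lev i} / D
  have hup' : ∀ i j : Fin m, lev' j < lev' i → N i j = 0 := by
    intro i j h
    refine hup i j (lt_of_not_ge fun hle => ?_)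
    exact absurd (coarse_mono lev D hle) (not_le.2 h)
  have hg' : ∀ u : Fin m, lev' u < m / D + 1 := fun u => coarse_lt lev D u
  have hs' : ∀ i : Fin m, Fintype.card {j : Fin m // lev' j = lev' i} ≤ 2 * D :=
    fun i => card_coarse_le lev D hD hs i
  exact sq_le_of_blockUpper_small N M hN hM lev' hup' hg' hs' hper

end Summit.ValiantsHypothesis.ValiantsHypothesis.Cruxes.TwoDimCoefficients.DimTwoCases

end
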